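import Summits.ABC.ABC.Theses.IsogenyGlueCongruence
import Summits.ABC.ABC.Theorems.IsogenyGlueCongruenceSemistableHeightPolyBound
import Summits.ABC.ABC.Theorems.IsogenyGlueCongruenceDegreePrimesPolyBoundedStubModularity
import HarnessLib

/-!
# Route `IsogenyGlueCongruence`, support item `SemistableHeightPolyBound` (stmt-ABC-13918) —
# the residual input: a log-quadratic bound for the curve's OWN minimal modular degree

Item `stmt-ABC-13918` (`∃ c, h_F(E) ≤ c · N_E²` for every semistable elliptic `E/ℚ` given by a
global minimal model `W`; `h_F = WeierstrassCurve.stableFaltingsHeight`, `N_E = W.conductorNorm ℤ`)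
is landed in the tree CONDITIONALLY from three trust bases (`pasten2024_height_lt`;
`ModularDatumExists` + `MazurKenkuBound`; `CDT_theorem_7_1_2` + `MazurKenkuBound`), all through the
classical modular approach (Frey; Murty–Pasten 2013 Thm 1.1; Pasten 2024 §3): Zagier's formula and
the trivial Petersson bound give (EqHDeg) `h(E) ≤ ½ log deg φ + O(1)` for the curve's own
parametrisation, and the isogeny-class transfer (Mazur–Kenku) is needed only to pass from
`deg φ_W` to the optimal degree `δ_{1,N}`, which Pasten's Thm 5.5 (a THEOREM of the tree,
`PastenShimura2024_thm_5_5_holds`) bounds.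

This helper file isolates the exact residual. Write `R` for: *there are `A`, `N₂` such that every
semistable globally minimal elliptic `W/ℚ` of conductor `N ≥ N₂` carries a modular parametrisation
datum at level `N` and `log(minModularDegree W N) ≤ A · N²`* — a statement about the curve's OWN
minimal modular degree (Frey's `deg φ_E`, `ModularDegreeMinimal.lean`), with no isogeny-class
transfer in it. Then:

* `semistableHeightPolyBound_of_logMinModularDegree_le` — **`R ⟹` the item** ((EqHDeg) per curve,
  `DegreePrimesPolyBounded.neronLatticeHeight_le_log_minModularDegree_of_nonempty`; `h_F ≤ h(E/ℚ)`;
  Shafarevich below the threshold, `exists_stableFaltingsHeight_le_of_conductorNorm_lt` — all PROVED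
  in the tree);
* `logMinModularDegree_le_of_polyDegree` — **the polynomial modular-degree statement for semistable
  curves ⟹ `R`** (the consequent of the route's crux B `PolyDegreeOfBoundedPrimes`, verbatim:
  `∃ κ C, ∀ W, semistable → ∃ D, deg D ≤ C · N^κ`), hence
  `semistableHeightPolyBound_of_polyDegree` and
  `semistableHeightPolyBound_of_degreePrimesPolyBounded_of_polyDegreeOfBoundedPrimes`: **inside the
  cone of the deciding theorem the item is implied by cruxes A ∧ B** — it cannot fail unless the
  route's waypoint fails (it is NOT claimed that this closes anything: the U-line uses the item to
  derive A);
* `logMinModularDegree_le_of_mazurKenkuBound_of_semistableModularDatum` — **`R` from the route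
  item `MazurKenkuBound` (stmt-ABC-15125) and the SEMISTABLE slice of the route item
  `ModularDatumExists` (stmt-ABC-15126)** with `A = log 163 + 1` (Mazur–Kenku:
  `deg φ_W ≤ 163 · δ_{1,N}`; Thm 5.5 and the trivial Hecke bound: `log δ_{1,N} ≤ N log N` for
  `N ≫ 1`, `exists_log_modularDegree_le_mul_log`), so that the closed glue
  `semistableHeightPolyBoundOfMazurKenku_proof` (the term `hHofMK hMK hMod` of the route's deciding
  theorem, rev 19) factors through `R`
  (`semistableHeightPolyBound_of_mazurKenkuBound_of_modularDatumExists`). Modularity enters only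
  through route items, never through an apex Literature fact.

Nothing here is unconditional progress on the item itself: `R` is not a theorem of the tree (the
density of the Néron lattice `Λ_W` relative to the Eichler–Shimura lattice `Λ_f`, i.e. the degree
of the isogeny from the optimal curve, is controlled only by Mazur–Kenku together with a
Néron-integrality input, see `PastenSpectralDegreeIsogenyBoundProofs`). No definition, no named
fact; helper for item stmt-ABC-13918.

## References

* [MurtyPasten2013] M. R. Murty, H. Pasten, *Modular forms and effective Diophantine
  approximation*, J. Number Theory 133 (2013) 3739–3754, Thm 1.1 (`h(E) ≪ N log N`).
* [PastenShimura2024] H. Pasten, *Shimura curves and the abc conjecture*, J. Number Theory 254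
  (2024) 214–335 = arXiv:1705.09251: §3 p. 13 ((EqFrey), (EqHDeg), Mazur–Kenku), Thm 5.5, Thm 7.2.
* [Frey1997Ternary] G. Frey, *On ternary equations of Fermat type and relations with elliptic
  curves*, in Modular Forms and Fermat's Last Theorem (1997), §3 p. 543 (the minimal degree
  `deg φ_E` and the degree conjecture).
-/

noncomputable section

-- `Summit.<Summit>.<Problem>` is the mandated summit-side namespace (CONVENTIONS §2); for the
-- single-conjunct summit `ABC` the two coincide, so the duplicate `ABC.ABC` is deliberate.
set_option linter.dupNamespace false

namespace Summit.ABC.ABC.Theorems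

open Literature.NumberTheory.EllipticCurves
open Literature.NumberTheory.EllipticCurves.ModularForms
open Literature.NumberTheory.EllipticCurves.Pasten2024
open Summit.ABC.ABC.Theses.IsogenyGlueCongruence

/-! ### `R ⟹` the item -/

/-- **The residual `R` implies `SemistableHeightPolyBound`.** If there are `A`, `N₂` such that
every semistable globally minimal elliptic `W/ℚ` of conductor `N ≥ N₂` carries a modular
parametrisation datum at level `N` with `log(minModularDegree W N) ≤ A · N²`, then
`∃ c, h_F(E) ≤ c · N²` for every semistable elliptic `E/ℚ` in global minimal form. Proof: above
the threshold, `h_F(E) ≤ h(E/ℚ) = neronLatticeHeight L ≤ ½ log(minModularDegree W N) + (2π − ½ log π)`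
(`stableFaltingsHeight_le_faltingsHeight_rat`, `faltingsHeight_eq_neronLatticeHeight`,
`exists_isNeronLatticeOf_holds`, (EqHDeg) per curve
`DegreePrimesPolyBounded.neronLatticeHeight_le_log_minModularDegree_of_nonempty`, and
`2π − ½ log π ≤ 9`, `two_pi_sub_half_log_pi_le`) `≤ (max A 0 / 2 + 9) · N²`; below it `h_F ≤ B` by
Shafarevich (`exists_stableFaltingsHeight_le_of_conductorNorm_lt`); `c = max B (max A 0 / 2 + 9)`,
using `N ≥ 1`. Unconditional implication; `R` itself is not proved in the tree.
[cite: PastenShimura2024, §3 p. 13, (EqFrey)–(EqHDeg)] [cite: MurtyPasten2013, Thm 1.1] -/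
theorem semistableHeightPolyBound_of_logMinModularDegree_le
    (hdeg : ∃ (A : ℝ) (N₂ : ℕ), ∀ (W : WeierstrassCurve ℚ) [W.IsElliptic] [W.IsGloballyMinimal]
      [NeZero (W.conductorNorm ℤ)], W.IsSemistable ℤ → N₂ ≤ W.conductorNorm ℤ →
        Nonempty (ModularParametrizationData W (W.conductorNorm ℤ)) ∧
          Real.log (minModularDegree W (W.conductorNorm ℤ) : ℝ) ≤
            A * (W.conductorNorm ℤ : ℝ) ^ 2) :
    SemistableHeightPolyBound := by
  unfold SemistableHeightPolyBound
  obtain ⟨A, N₂, hA⟩ := hdeg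
  obtain ⟨B, hB⟩ := exists_stableFaltingsHeight_le_of_conductorNorm_lt N₂
  refine ⟨max B (max A 0 / 2 + 9), fun W _ _ _ hss => ?_⟩
  have hN1 : (1 : ℝ) ≤ (W.conductorNorm ℤ : ℝ) := by
    exact_mod_cast Nat.one_le_iff_ne_zero.2 (NeZero.ne _)
  have hsq : (1 : ℝ) ≤ (W.conductorNorm ℤ : ℝ) ^ 2 := by nlinarith
  have hA0 : (0 : ℝ) ≤ max A 0 := le_max_right _ _
  have hc9 : (0 : ℝ) ≤ max A 0 / 2 + 9 := by positivity
  have hc0 : (0 : ℝ) ≤ max B (max A 0 / 2 + 9) := le_trans hc9 (le_max_right _ _)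
  by_cases hN : N₂ ≤ W.conductorNorm ℤ
  · obtain ⟨hW, hlog⟩ := hA W hss hN
    obtain ⟨L, hL⟩ := exists_isNeronLatticeOf_holds (W.baseChange ℂ)
    have hh :=
      DegreePrimesPolyBounded.neronLatticeHeight_le_log_minModularDegree_of_nonempty W hW L hL
    have hπ := two_pi_sub_half_log_pi_le
    have h163 : (0 : ℝ) ≤ Real.log 163 := Real.log_nonneg (by norm_num)
    have hAle : A * (W.conductorNorm ℤ : ℝ) ^ 2 ≤ max A 0 * (W.conductorNorm ℤ : ℝ) ^ 2 :=
      mul_le_mul_of_nonneg_right (le_max_left _ _) (by positivity)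
    have h9 : (9 : ℝ) ≤ 9 * (W.conductorNorm ℤ : ℝ) ^ 2 := by nlinarith
    calc W.stableFaltingsHeight ≤ W.faltingsHeight := stableFaltingsHeight_le_faltingsHeight_rat W
      _ = neronLatticeHeight L := faltingsHeight_eq_neronLatticeHeight W hL
      _ ≤ Real.log (minModularDegree W (W.conductorNorm ℤ) : ℝ) / 2 +
            (2 * Real.pi - Real.log Real.pi / 2) := hh
      _ ≤ max A 0 * (W.conductorNorm ℤ : ℝ) ^ 2 / 2 + 9 := by linarith
      _ ≤ (max A 0 / 2 + 9) * (W.conductorNorm ℤ : ℝ) ^ 2 := by nlinarith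
      _ ≤ max B (max A 0 / 2 + 9) * (W.conductorNorm ℤ : ℝ) ^ 2 :=
          mul_le_mul_of_nonneg_right (le_max_right _ _) (by positivity)
  · have hlt : W.conductorNorm ℤ < N₂ := lt_of_not_ge hN
    calc W.stableFaltingsHeight ≤ B := hB W hlt
      _ ≤ max B (max A 0 / 2 + 9) := le_max_left _ _
      _ = max B (max A 0 / 2 + 9) * 1 := (mul_one _).symm
      _ ≤ max B (max A 0 / 2 + 9) * (W.conductorNorm ℤ : ℝ) ^ 2 :=
          mul_le_mul_of_nonneg_left hsq hc0

/-! ### The polynomial modular-degree statement `⟹ R ⟹` the item -/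

/-- **The polynomial modular-degree statement for semistable curves implies `R`.** If
`∃ κ C, ∀ W` (semistable, globally minimal, elliptic) `∃ D, deg D ≤ C · N^κ` — verbatim the
consequent of the route's crux B `PolyDegreeOfBoundedPrimes` (= the antecedent of
`SharpDegreeOfPolyDegree`; Frey's degree conjecture, Pasten 2024 Conj 3.2,
restricted to semistable curves) — then every such `W` carries a datum and
`log(minModularDegree W N) ≤ (|log C| + |κ|) · N²` (`minModularDegree ≤ deg D`, `log N ≤ N²`,
`N ≥ 1`; `C > 0` is forced by `deg D ≥ 1`). [cite: PastenShimura2024, Conj 3.2 and §3 p. 13] -/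
theorem logMinModularDegree_le_of_polyDegree
    (hpoly : ∃ κ C : ℝ, ∀ (W : WeierstrassCurve ℚ) [W.IsElliptic] [W.IsGloballyMinimal]
      [NeZero (W.conductorNorm ℤ)], W.IsSemistable ℤ →
        ∃ D : ModularParametrizationData W (W.conductorNorm ℤ),
          (D.modularDegree : ℝ) ≤ C * (W.conductorNorm ℤ : ℝ) ^ κ) :
    ∃ (A : ℝ) (N₂ : ℕ), ∀ (W : WeierstrassCurve ℚ) [W.IsElliptic] [W.IsGloballyMinimal]
      [NeZero (W.conductorNorm ℤ)], W.IsSemistable ℤ → N₂ ≤ W.conductorNorm ℤ →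
        Nonempty (ModularParametrizationData W (W.conductorNorm ℤ)) ∧
          Real.log (minModularDegree W (W.conductorNorm ℤ) : ℝ) ≤
            A * (W.conductorNorm ℤ : ℝ) ^ 2 := by
  obtain ⟨κ, C, h⟩ := hpoly
  refine ⟨|Real.log C| + |κ|, 0, fun W _ _ _ hss _ => ?_⟩
  obtain ⟨D, hD⟩ := h W hss
  refine ⟨⟨D⟩, ?_⟩
  have hN1 : (1 : ℝ) ≤ (W.conductorNorm ℤ : ℝ) := by
    exact_mod_cast Nat.one_le_iff_ne_zero.2 (NeZero.ne _)
  have hNpos : (0 : ℝ) < (W.conductorNorm ℤ : ℝ) := by linarith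
  have hsq : (1 : ℝ) ≤ (W.conductorNorm ℤ : ℝ) ^ 2 := by nlinarith
  have hNκ : 0 < (W.conductorNorm ℤ : ℝ) ^ κ := Real.rpow_pos_of_pos hNpos κ
  have hD1 : (1 : ℝ) ≤ D.modularDegree := by exact_mod_cast D.deg_pos
  -- `C > 0`, since `1 ≤ deg D ≤ C · N^κ` and `N^κ > 0`
  have hC : 0 < C := by
    by_contra hC
    push Not at hC
    have : C * (W.conductorNorm ℤ : ℝ) ^ κ ≤ 0 := mul_nonpos_of_nonpos_of_nonneg hC hNκ.le
    linarith
  have hmin0 : (0 : ℝ) < minModularDegree W (W.conductorNorm ℤ) := by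
    exact_mod_cast minModularDegree_pos D
  have hminle : (minModularDegree W (W.conductorNorm ℤ) : ℝ) ≤ D.modularDegree := by
    exact_mod_cast minModularDegree_le D
  -- `log(min) ≤ log(deg D) ≤ log C + κ log N`
  have h1 : Real.log (minModularDegree W (W.conductorNorm ℤ) : ℝ) ≤
      Real.log C + κ * Real.log (W.conductorNorm ℤ : ℝ) := by
    have h2 := Real.log_le_log hmin0 (hminle.trans hD)
    rwa [Real.log_mul hC.ne' hNκ.ne', Real.log_rpow hNpos] at h2
  -- `log N ≤ N²` and `log C ≤ |log C| · N²`, `κ log N ≤ |κ| · N²`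
  have hlog0 : 0 ≤ Real.log (W.conductorNorm ℤ : ℝ) := Real.log_nonneg hN1
  have hlogN' : Real.log (W.conductorNorm ℤ : ℝ) ≤ (W.conductorNorm ℤ : ℝ) :=
    (Real.log_le_sub_one_of_pos hNpos).trans (by linarith)
  have hlogN : Real.log (W.conductorNorm ℤ : ℝ) ≤ (W.conductorNorm ℤ : ℝ) ^ 2 :=
    hlogN'.trans (by nlinarith)
  have h3 : Real.log C ≤ |Real.log C| * (W.conductorNorm ℤ : ℝ) ^ 2 :=
    (le_abs_self _).trans (by nlinarith [abs_nonneg (Real.log C)])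
  have h4 : κ * Real.log (W.conductorNorm ℤ : ℝ) ≤ |κ| * (W.conductorNorm ℤ : ℝ) ^ 2 :=
    (mul_le_mul_of_nonneg_right (le_abs_self κ) hlog0).trans
      (mul_le_mul_of_nonneg_left hlogN (abs_nonneg κ))
  calc Real.log (minModularDegree W (W.conductorNorm ℤ) : ℝ)
      ≤ Real.log C + κ * Real.log (W.conductorNorm ℤ : ℝ) := h1
    _ ≤ |Real.log C| * (W.conductorNorm ℤ : ℝ) ^ 2 + |κ| * (W.conductorNorm ℤ : ℝ) ^ 2 := by
        linarith
    _ = (|Real.log C| + |κ|) * (W.conductorNorm ℤ : ℝ) ^ 2 := by ring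

/-- **The polynomial modular-degree statement for semistable curves implies the item**
(`logMinModularDegree_le_of_polyDegree` + `semistableHeightPolyBound_of_logMinModularDegree_le`):
polynomial `deg φ_E ≤ C N^κ` gives `h_F(E) ≤ c N²` with no isogeny-class transfer, since the
hypothesis is about the curve's own parametrisation. [cite: PastenShimura2024, §3 p. 13, (EqHDeg)] -/
theorem semistableHeightPolyBound_of_polyDegree
    (hpoly : ∃ κ C : ℝ, ∀ (W : WeierstrassCurve ℚ) [W.IsElliptic] [W.IsGloballyMinimal]
      [NeZero (W.conductorNorm ℤ)], W.IsSemistable ℤ →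
        ∃ D : ModularParametrizationData W (W.conductorNorm ℤ),
          (D.modularDegree : ℝ) ≤ C * (W.conductorNorm ℤ : ℝ) ^ κ) :
    SemistableHeightPolyBound :=
  semistableHeightPolyBound_of_logMinModularDegree_le (logMinModularDegree_le_of_polyDegree hpoly)

/-- **Inside the cone of the deciding theorem, cruxes A and B imply the item**: from
`DegreePrimesPolyBounded` (crux A, stmt-ABC-2045) and `PolyDegreeOfBoundedPrimes` (crux B,
stmt-ABC-2046) one gets the polynomial modular-degree statement `hB hA`, hence
`SemistableHeightPolyBound` (`semistableHeightPolyBound_of_polyDegree`). A consistency statement,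
not a closure: on the U-line the item is an INPUT towards A (`DegreePrimesOfGluingBound`), so this
implication shows only that the item cannot fail unless the route's waypoint (polynomial modular
degree for semistable curves) fails. [cite: PastenShimura2024, Conj 3.2 and §3 p. 13] -/
theorem semistableHeightPolyBound_of_degreePrimesPolyBounded_of_polyDegreeOfBoundedPrimes
    (hA : DegreePrimesPolyBounded) (hB : PolyDegreeOfBoundedPrimes) : SemistableHeightPolyBound :=
  semistableHeightPolyBound_of_polyDegree (hB hA)

/-! ### `R` from Mazur–Kenku and the semistable slice of modularity -/

/-- **`R` from the route item `MazurKenkuBound` (stmt-ABC-15125) and the semistable slice of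
modularity**, with `A = log 163 + 1`: if every semistable globally minimal elliptic `W/ℚ` carries a
datum at level `N_W` (Wiles 1995 Thm 0.4 + Taylor–Wiles in datum form; the semistable slice of the
route item `ModularDatumExists`, stmt-ABC-15126) and `MazurKenkuBound` holds (the minimal
degree of `W` is `≤ 163 · δ_{1,N}`, Mazur 1978 + Kenku 1982 via Pasten 2024 §3), then for
`N ≥ N₂`: `log(minModularDegree W N) ≤ log 163 + log δ_{1,N} ≤ log 163 + N log N ≤
(log 163 + 1) · N²`, where `δ_{1,N}` is the degree of a class-minimal datum
(`exists_minimal_datum_in_class`) and `log δ_{1,N} ≤ N log N` is the tree theorem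
`exists_log_modularDegree_le_mul_log` (Pasten's Thm 5.5, `PastenShimura2024_thm_5_5_holds`, with
the trivial Hecke bound). The hypothesis `hslice` is hypothesis (1) of the A-line stub
`DegreePrimesPolyBounded.stub_discValuationOfSemistableModularity` verbatim, supplied from
`ModularDatumExists` by `DegreePrimesPolyBounded.semistableModularDatum_of_modularDatumExists`.
CONDITIONAL on `MazurKenkuBound` and `hslice`. [cite: PastenShimura2024, §3 p. 13, Thm 5.5, Thm 7.2] -/
theorem logMinModularDegree_le_of_mazurKenkuBound_of_semistableModularDatum
    (hMK : MazurKenkuBound)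
    (hslice : ∀ (W : WeierstrassCurve ℚ) [W.IsElliptic] [W.IsGloballyMinimal]
      [NeZero (W.conductorNorm ℤ)], W.IsSemistable ℤ →
        Nonempty (ModularParametrizationData W (W.conductorNorm ℤ))) :
    ∃ (A : ℝ) (N₂ : ℕ), ∀ (W : WeierstrassCurve ℚ) [W.IsElliptic] [W.IsGloballyMinimal]
      [NeZero (W.conductorNorm ℤ)], W.IsSemistable ℤ → N₂ ≤ W.conductorNorm ℤ →
        Nonempty (ModularParametrizationData W (W.conductorNorm ℤ)) ∧
          Real.log (minModularDegree W (W.conductorNorm ℤ) : ℝ) ≤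
            A * (W.conductorNorm ℤ : ℝ) ^ 2 := by
  obtain ⟨N₂, hN₂⟩ := exists_log_modularDegree_le_mul_log PastenShimura2024_thm_5_5_holds
  refine ⟨Real.log 163 + 1, N₂, fun W _ _ _ hss hN => ?_⟩
  have hW := hslice W hss
  refine ⟨hW, ?_⟩
  obtain ⟨D', hD'min, hD'le⟩ := exists_minimal_datum hW
  obtain ⟨W₀, hW₀, D₀, hf, hmin⟩ := exists_minimal_datum_in_class D'
  have hf' : D'.f = D₀.f := hf.symm
  have hle : D'.modularDegree ≤ 163 * D₀.modularDegree :=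
    hMK (W.conductorNorm ℤ) W₀ W D₀ D' hf' hmin hD'le
  have hδ := hN₂ (W.conductorNorm ℤ) W₀ D₀ hmin hN
  have hd₀ : (0 : ℝ) < D₀.modularDegree := by exact_mod_cast D₀.deg_pos
  have hd' : (0 : ℝ) < D'.modularDegree := by exact_mod_cast D'.deg_pos
  have hlog : Real.log (minModularDegree W (W.conductorNorm ℤ) : ℝ) ≤
      Real.log 163 + Real.log (D₀.modularDegree : ℝ) := by
    rw [← hD'min, ← Real.log_mul (by norm_num) hd₀.ne']
    exact Real.log_le_log hd' (by exact_mod_cast hle)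
  have hN1 : (1 : ℝ) ≤ (W.conductorNorm ℤ : ℝ) := by
    exact_mod_cast Nat.one_le_iff_ne_zero.2 (NeZero.ne _)
  have hNpos : (0 : ℝ) < (W.conductorNorm ℤ : ℝ) := by linarith
  have hsq : (1 : ℝ) ≤ (W.conductorNorm ℤ : ℝ) ^ 2 := by nlinarith
  have hlogN : Real.log (W.conductorNorm ℤ : ℝ) ≤ (W.conductorNorm ℤ : ℝ) :=
    (Real.log_le_sub_one_of_pos hNpos).trans (by linarith)
  have hNN : (W.conductorNorm ℤ : ℝ) * Real.log (W.conductorNorm ℤ) ≤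
      (W.conductorNorm ℤ : ℝ) ^ 2 := by
    rw [sq]
    exact mul_le_mul_of_nonneg_left hlogN hNpos.le
  have h163 : (0 : ℝ) ≤ Real.log 163 := Real.log_nonneg (by norm_num)
  have h163' : Real.log 163 ≤ Real.log 163 * (W.conductorNorm ℤ : ℝ) ^ 2 := by nlinarith
  calc Real.log (minModularDegree W (W.conductorNorm ℤ) : ℝ)
      ≤ Real.log 163 + Real.log (D₀.modularDegree : ℝ) := hlog
    _ ≤ Real.log 163 + (W.conductorNorm ℤ : ℝ) * Real.log (W.conductorNorm ℤ) := by linarith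
    _ ≤ Real.log 163 * (W.conductorNorm ℤ : ℝ) ^ 2 + (W.conductorNorm ℤ : ℝ) ^ 2 := by linarith
    _ = (Real.log 163 + 1) * (W.conductorNorm ℤ : ℝ) ^ 2 := by ring

/-- **The closed glue `MazurKenkuBound → ModularDatumExists → SemistableHeightPolyBound`
(stmt-ABC-15128, `semistableHeightPolyBoundOfMazurKenku_proof`) factors through the residual `R`**:
`logMinModularDegree_le_of_mazurKenkuBound_of_semistableModularDatum` (with the slice supplied by
`ModularDatumExists`, semistability forgotten — the tree's
`DegreePrimesPolyBounded.semistableModularDatum_of_modularDatumExists`) followed by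
`semistableHeightPolyBound_of_logMinModularDegree_le`. CONDITIONAL on the two route items.
[cite: PastenShimura2024, §3 p. 13] -/
theorem semistableHeightPolyBound_of_mazurKenkuBound_of_modularDatumExists
    (hMK : MazurKenkuBound) (hmod : ModularDatumExists) : SemistableHeightPolyBound :=
  semistableHeightPolyBound_of_logMinModularDegree_le
    (logMinModularDegree_le_of_mazurKenkuBound_of_semistableModularDatum hMK
      (DegreePrimesPolyBounded.semistableModularDatum_of_modularDatumExists hmod))

end Summit.ABC.ABC.Theorems

end
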